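import Mathlib
import Summits.AnomalousDissipation.AnomalousDissipation.Theses.PointSink
import Summits.AnomalousDissipation.AnomalousDissipation.Theorems.PointSinkSolitonTransplantCoreEnergyIdentity

/-!
# `PointSink.SolitonTransplant` (stmt-AnomalousDissipation-19035): the exact core family of a
cascade soliton feeds the origin — its inward energy flux through every sphere tends to `D`

Lead record (line `Sketch`, continuation seat c1), companion of the landed exact-core-family stub
`stub_solitonCoreFamily` (S6b, `Theorems/PointSinkSolitonTransplantStubSolitonCoreFamily.lean`),
of the free-space weighted steady energy identity
(`freeSpace_steady_weighted_energy_identity`, `PointSinkSolitonTransplantCoreEnergyIdentity.lean`)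
and the free-space twin of `Negative/PointSinkEnergyFlux.lean`.

* `coreFamily_energyFlux_tendsto` — along a family `(ν_j, c_j, π_j)` of smooth steady zero-force
  Navier–Stokes solutions on `ℝ³` with `ν_j → 0`, exact dissipation `ν_j∫|∇c_j|² = D`, point
  concentration `ν_j∫_{|y|≥r}|∇c_j|² → 0` and locally bounded energy, for every compactly supported
  smooth `ψ` equal to `1` on a ball `B_r(0)`: `∫ (½‖c_j‖² + π_j) Dψ[c_j] → D`. With `ψ` radially
  decreasing this is the INWARD energy flux of the cores through the level spheres of `ψ`: the
  dissipation `D` burnt at the origin is supplied, in the limit, entirely by the cubic flux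
  `(½‖c‖²+π)c` from outside every ball — the free-space picture behind observation (O3) of
  `LeadAnalysisC1.md` (on `T³` the same flux must be supplied by the stirring and cross every shell
  separating it from the sink, `Negative/PointSinkEnergyFlux*.lean`).
* `coreFamily_locallyBoundedEnergy` — the local energy bound from `L²`-convergence of the cores to
  a locally square-integrable cone on balls (the last clause of `stub_solitonCoreFamily`).

Pure proof file; no definitions, no named facts. [folklore]
-/

-- `Summit.<Summit>.<Problem>` is the tree's mandated summit-side namespace (CONVENTIONS §2); for this
-- single-conjunct summit the two coincide, so the duplicate is deliberate.
set_option linter.dupNamespace false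

noncomputable section

namespace Summit.AnomalousDissipation.AnomalousDissipation.Theorems

open MeasureTheory Filter Topology Set Metric Function
open scoped InnerProductSpace ContDiff Laplacian
open Literature.Analysis.FunctionSpaces Literature.Analysis.FluidPDE

/-! ### The inward energy flux of a concentrating core family -/

/-- Young-type absorption: for `s ≥ 0` and reals `a, b`, `s² a b ≤ (s a² + s³ b²)/2`. [folklore] -/
private theorem sq_mul_mul_le_aux {s a b : ℝ} (hs : 0 ≤ s) :
    s ^ 2 * a * b ≤ (s * a ^ 2 + s ^ 3 * b ^ 2) / 2 := by
  nlinarith [mul_nonneg hs (sq_nonneg (a - s * b))]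

/-- The derivative of a function that is locally constant near `x` vanishes at `x`. [folklore] -/
private theorem fderiv_eq_zero_of_eventuallyEq_const {ψ : (EuclideanSpace ℝ (Fin 3)) → ℝ} {x : (EuclideanSpace ℝ (Fin 3))} {a : ℝ}
    (h : ∀ᶠ y in 𝓝 x, ψ y = a) : fderiv ℝ ψ x = 0 := by
  have h' : ψ =ᶠ[𝓝 x] fun _ => a := h
  rw [h'.fderiv_eq]
  simp

/-- **The cores feed the origin: inward energy flux `→ D`.** Let `(ν_j, c_j, π_j)` be smooth
steady zero-force Navier–Stokes solutions on `ℝ³` with `ν_j > 0`, `ν_j → 0`, integrable `|∇c_j|²`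
with the exact dissipation identity `ν_j ∫|∇c_j|² = D`, point concentration
`ν_j ∫_{r ≤ |y|} |∇c_j|² → 0` for every `r > 0`, and locally bounded energy
`sup_j ∫_{B_R} ‖c_j‖² < ∞` for every `R`. Then for every compactly supported smooth weight `ψ`
with `ψ = 1` on a ball `B_r(0)`: `∫ (½‖c_j‖² + π_j) Dψ[c_j] → D`. Proof: in
`freeSpace_steady_weighted_energy_identity` the weighted dissipation is
`D − ν_j∫(1−ψ)|∇c_j|² = D + o(1)` (`1 − ψ` lives on `{r ≤ |y|}`), and the transport term is
`≤ ‖Dψ‖_∞ (3√ν_j sup_j∫_K‖c_j‖² + √ν_j · ν_j∫_{r≤|y|}|∇c_j|²)/2 → 0` (`K ⊇ supp Dψ`, Young).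
[folklore] -/
theorem coreFamily_energyFlux_tendsto
    (ν : ℕ → ℝ) (cr : ℕ → (EuclideanSpace ℝ (Fin 3)) → (EuclideanSpace ℝ (Fin 3))) (π : ℕ → (EuclideanSpace ℝ (Fin 3)) → ℝ)
    (hν : ∀ j, 0 < ν j) (hν0 : Tendsto ν atTop (𝓝 0))
    (hcore : ∀ j, IsClassicalNSSolutionOn Set.univ (ν j) (fun _ _ => 0) (fun _ => cr j) (fun _ => π j))
    (hInt : ∀ j, Integrable (fun y => frobeniusNormSq (fderiv ℝ (cr j) y)))
    {D : ℝ} (hD : ∀ j, ν j * ∫ y, frobeniusNormSq (fderiv ℝ (cr j) y) = D)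
    (hconc : ∀ r : ℝ, 0 < r → Tendsto (fun j => ν j *
      ∫ y in {y : (EuclideanSpace ℝ (Fin 3)) | r ≤ ‖y‖}, frobeniusNormSq (fderiv ℝ (cr j) y)) atTop (𝓝 0))
    (hL2 : ∀ R : ℝ, 0 < R → ∃ C : ℝ, ∀ j, ∫ y in ball (0 : (EuclideanSpace ℝ (Fin 3))) R, ‖cr j y‖ ^ 2 ≤ C)
    {ψ : (EuclideanSpace ℝ (Fin 3)) → ℝ} (hψ : ContDiff ℝ ∞ ψ) (hψc : HasCompactSupport ψ) {r : ℝ} (hr : 0 < r)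
    (hψ1 : ∀ x : (EuclideanSpace ℝ (Fin 3)), ‖x‖ < r → ψ x = 1) :
    Tendsto (fun j => ∫ x, (2⁻¹ * ‖cr j x‖ ^ 2 + π j x) * fderiv ℝ ψ x (cr j x)) atTop (𝓝 D) := by
  -- smoothness and continuity
  have hc : ∀ j, ContDiff ℝ ∞ (cr j) := fun j => (hcore j).contDiff_velocity (Set.mem_univ (0 : ℝ))
  have hc1 : ∀ j, ContDiff ℝ 1 (cr j) := fun j => (hc j).of_le (by exact_mod_cast le_top)
  have cc : ∀ j, Continuous (cr j) := fun j => (hc j).continuous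
  have cDc : ∀ j, Continuous (fderiv ℝ (cr j)) := fun j => (hc1 j).continuous_fderiv one_ne_zero
  have hψ1' : ContDiff ℝ 1 ψ := hψ.of_le (by exact_mod_cast le_top)
  have cψ : Continuous ψ := hψ.continuous
  have cDψ : Continuous (fderiv ℝ ψ) := hψ1'.continuous_fderiv one_ne_zero
  have hψDc : HasCompactSupport (fderiv ℝ ψ) := hψc.fderiv (𝕜 := ℝ)
  -- the Frobenius density and its pieces
  set Fr : ℕ → (EuclideanSpace ℝ (Fin 3)) → ℝ := fun j y => frobeniusNormSq (fderiv ℝ (cr j) y) with hFr_def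
  have hFr0 : ∀ j y, 0 ≤ Fr j y := fun j y => frobeniusNormSq_nonneg _
  have hFrsum : ∀ j y, Fr j y = ∑ i, ‖fderiv ℝ (cr j) y ((EuclideanSpace.basisFun (Fin 3) ℝ) i)‖ ^ 2 := fun j y =>
    frobeniusNormSq_eq_sum (EuclideanSpace.basisFun (Fin 3) ℝ) _
  have cFr : ∀ j, Continuous (Fr j) := fun j => by
    simp only [hFr_def]
    simp_rw [frobeniusNormSq_eq_sum (EuclideanSpace.basisFun (Fin 3) ℝ)]
    exact continuous_finsetSum _ fun i _ => ((cDc j).clm_apply continuous_const).norm.pow 2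
  -- bounds for `ψ` and `Dψ`, a ball containing the support of `ψ`
  obtain ⟨Cψ, hCψ⟩ := (hψc.isCompact_range cψ).isBounded.exists_norm_le
  have hCψ' : ∀ x, |ψ x| ≤ Cψ := fun x => (Real.norm_eq_abs _).symm.le.trans (hCψ _ ⟨x, rfl⟩)
  have hCψ0 : 0 ≤ Cψ := (abs_nonneg _).trans (hCψ' 0)
  obtain ⟨Cd, hCd⟩ := (hψDc.isCompact_range cDψ).isBounded.exists_norm_le
  have hCd' : ∀ x, ‖fderiv ℝ ψ x‖ ≤ Cd := fun x => hCd _ ⟨x, rfl⟩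
  have hCd0 : 0 ≤ Cd := (norm_nonneg _).trans (hCd' 0)
  obtain ⟨Rψ, hRψ⟩ := hψc.isCompact.isBounded.subset_closedBall 0
  have hRψ' : 0 < max Rψ 1 + 1 := by positivity
  set K : Set (EuclideanSpace ℝ (Fin 3)) := ball (0 : (EuclideanSpace ℝ (Fin 3))) (max Rψ 1 + 1) with hK_def
  have hKm : MeasurableSet K := measurableSet_ball
  have hsuppK : ∀ x, x ∉ K → fderiv ℝ ψ x = 0 := by
    intro x hx
    apply fderiv_of_notMem_tsupport ℝ
    intro hx'
    have h1 : x ∈ closedBall (0 : (EuclideanSpace ℝ (Fin 3))) Rψ := hRψ hx'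
    apply hx
    simp only [hK_def, mem_ball, dist_zero_right]
    simp only [mem_closedBall, dist_zero_right] at h1
    linarith [le_max_left Rψ 1]
  obtain ⟨CK, hCK⟩ := hL2 (max Rψ 1 + 1) hRψ'
  have hCK0 : 0 ≤ CK := le_trans (setIntegral_nonneg hKm fun y _ => sq_nonneg _) (hCK 0)
  -- the exterior set, on which `1 − ψ` and `Dψ` live
  set A : Set (EuclideanSpace ℝ (Fin 3)) := {y | r ≤ ‖y‖} with hA_def
  have hAm : MeasurableSet A := (isClosed_le continuous_const continuous_norm).measurableSet
  have hAc : ∀ x, x ∉ A → ‖x‖ < r := fun x hx => by simpa [hA_def] using hx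
  have hDψA : ∀ x, x ∉ A → fderiv ℝ ψ x = 0 := by
    intro x hx
    refine fderiv_eq_zero_of_eventuallyEq_const (a := 1) ?_
    have ho : IsOpen {y : (EuclideanSpace ℝ (Fin 3)) | ‖y‖ < r} := isOpen_lt continuous_norm continuous_const
    exact Filter.eventually_of_mem (ho.mem_nhds (hAc x hx)) fun y hy => hψ1 y hy
  -- notation
  set FL : ℕ → ℝ := fun j => ∫ x, (2⁻¹ * ‖cr j x‖ ^ 2 + π j x) * fderiv ℝ ψ x (cr j x)
    with hFL_def
  set G : ℕ → ℝ := fun j => ∫ y in A, Fr j y with hG_def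
  have hG0 : ∀ j, 0 ≤ G j := fun j => setIntegral_nonneg hAm fun y _ => hFr0 j y
  set T1 : ℕ → ℝ := fun j => ∫ x, ψ x * Fr j x with hT1_def
  set T2 : ℕ → ℝ := fun j => ∫ x, ∑ i, fderiv ℝ ψ x ((EuclideanSpace.basisFun (Fin 3) ℝ) i) * ⟪cr j x, fderiv ℝ (cr j) x ((EuclideanSpace.basisFun (Fin 3) ℝ) i)⟫_ℝ
    with hT2_def
  have hid : ∀ j, FL j = ν j * T1 j + ν j * T2 j := fun j =>
    freeSpace_steady_weighted_energy_identity (hcore j) hψ hψc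
  -- (i) the weighted dissipation: `|ν T1 − D| ≤ (1 + Cψ) ν G`
  have hT1 : ∀ j, |ν j * T1 j - D| ≤ (1 + Cψ) * (ν j * G j) := by
    intro j
    have hI1 : Integrable (fun x => (1 - ψ x) * Fr j x) := by
      have := (hInt j).sub ((hInt j).bdd_mul (c := Cψ) cψ.aestronglyMeasurable
        (ae_of_all _ fun x => (Real.norm_eq_abs _).le.trans (hCψ' x)))
      refine this.congr (ae_of_all _ fun x => ?_)
      simp only [Pi.sub_apply]
      ring
    have hT1eq : T1 j = (∫ x, Fr j x) - ∫ x, (1 - ψ x) * Fr j x := by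
      simp only [hT1_def]
      rw [← integral_sub (hInt j) hI1]
      refine integral_congr_ae (ae_of_all _ fun x => ?_)
      ring
    have hbound : ∀ x, ‖(1 - ψ x) * Fr j x‖ ≤ (1 + Cψ) * A.indicator (Fr j) x := by
      intro x
      by_cases hx : x ∈ A
      · rw [Set.indicator_of_mem hx, norm_mul, Real.norm_eq_abs, Real.norm_eq_abs,
          abs_of_nonneg (hFr0 j x)]
        refine mul_le_mul_of_nonneg_right ?_ (hFr0 j x)
        calc |1 - ψ x| ≤ |(1 : ℝ)| + |ψ x| := abs_sub _ _
          _ ≤ 1 + Cψ := by rw [abs_one]; linarith [hCψ' x]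
      · rw [Set.indicator_of_notMem hx, hψ1 x (hAc x hx)]
        simp
    have hint : Integrable (fun x => (1 + Cψ) * A.indicator (Fr j) x) :=
      (((hInt j).indicator hAm)).const_mul _
    have h := norm_integral_le_of_norm_le hint (ae_of_all _ hbound)
    rw [integral_const_mul, integral_indicator hAm, Real.norm_eq_abs] at h
    have hD' : ν j * ∫ x, Fr j x = D := hD j
    have hrew : ν j * T1 j - D = -(ν j * ∫ x, (1 - ψ x) * Fr j x) := by
      rw [hT1eq, mul_sub, hD']; ring
    calc |ν j * T1 j - D| = |ν j * ∫ x, (1 - ψ x) * Fr j x| := by rw [hrew, abs_neg]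
      _ = ν j * |∫ x, (1 - ψ x) * Fr j x| := by rw [abs_mul, abs_of_pos (hν j)]
      _ ≤ ν j * ((1 + Cψ) * G j) := mul_le_mul_of_nonneg_left h (hν j).le
      _ = (1 + Cψ) * (ν j * G j) := by ring
  -- (ii) the transport: `|ν T2| ≤ Cd (3 √ν CK + √ν (ν G)) / 2`
  have hT2 : ∀ j, |ν j * T2 j| ≤
      Cd * (3 * (Real.sqrt (ν j) * CK) + Real.sqrt (ν j) * (ν j * G j)) / 2 := by
    intro j
    set s : ℝ := Real.sqrt (ν j) with hs_def
    have hs0 : 0 ≤ s := Real.sqrt_nonneg _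
    have hs2 : s ^ 2 = ν j := Real.sq_sqrt (hν j).le
    have hdψ : ∀ i x, |fderiv ℝ ψ x ((EuclideanSpace.basisFun (Fin 3) ℝ) i)| ≤ Cd := by
      intro i x
      calc |fderiv ℝ ψ x ((EuclideanSpace.basisFun (Fin 3) ℝ) i)| = ‖fderiv ℝ ψ x ((EuclideanSpace.basisFun (Fin 3) ℝ) i)‖ := (Real.norm_eq_abs _).symm
        _ ≤ ‖fderiv ℝ ψ x‖ * ‖((EuclideanSpace.basisFun (Fin 3) ℝ) i : (EuclideanSpace ℝ (Fin 3)))‖ := ContinuousLinearMap.le_opNorm _ _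
        _ ≤ Cd * 1 := by
            gcongr
            · exact hCd' x
            · rw [(EuclideanSpace.basisFun (Fin 3) ℝ).orthonormal.1 i]
        _ = Cd := mul_one _
    -- pointwise Young bound with indicators of `K` (energy) and `A` (gradient)
    have hpt : ∀ x, ‖ν j * ∑ i, fderiv ℝ ψ x ((EuclideanSpace.basisFun (Fin 3) ℝ) i) * ⟪cr j x, fderiv ℝ (cr j) x ((EuclideanSpace.basisFun (Fin 3) ℝ) i)⟫_ℝ‖ ≤
        ∑ i, Cd * ((s * K.indicator (fun x => ‖cr j x‖ ^ 2) x +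
          s ^ 3 * A.indicator (fun x => ‖fderiv ℝ (cr j) x ((EuclideanSpace.basisFun (Fin 3) ℝ) i)‖ ^ 2) x) / 2) := by
      intro x
      by_cases hxK : x ∈ K
      · by_cases hxA : x ∈ A
        · simp_rw [Set.indicator_of_mem hxK, Set.indicator_of_mem hxA]
          rw [Real.norm_eq_abs, abs_mul, abs_of_pos (hν j)]
          calc ν j * |∑ i, fderiv ℝ ψ x ((EuclideanSpace.basisFun (Fin 3) ℝ) i) * ⟪cr j x, fderiv ℝ (cr j) x ((EuclideanSpace.basisFun (Fin 3) ℝ) i)⟫_ℝ|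
              ≤ ν j * ∑ i, |fderiv ℝ ψ x ((EuclideanSpace.basisFun (Fin 3) ℝ) i) * ⟪cr j x, fderiv ℝ (cr j) x ((EuclideanSpace.basisFun (Fin 3) ℝ) i)⟫_ℝ| := by
                gcongr
                · exact (hν j).le
                · exact Finset.abs_sum_le_sum_abs _ _
            _ = ∑ i, ν j * |fderiv ℝ ψ x ((EuclideanSpace.basisFun (Fin 3) ℝ) i) * ⟪cr j x, fderiv ℝ (cr j) x ((EuclideanSpace.basisFun (Fin 3) ℝ) i)⟫_ℝ| :=
                Finset.mul_sum _ _ _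
            _ ≤ _ := Finset.sum_le_sum fun i _ => ?_
          rw [abs_mul]
          have h1 : |⟪cr j x, fderiv ℝ (cr j) x ((EuclideanSpace.basisFun (Fin 3) ℝ) i)⟫_ℝ| ≤
              ‖cr j x‖ * ‖fderiv ℝ (cr j) x ((EuclideanSpace.basisFun (Fin 3) ℝ) i)‖ := abs_real_inner_le_norm _ _
          calc ν j * (|fderiv ℝ ψ x ((EuclideanSpace.basisFun (Fin 3) ℝ) i)| * |⟪cr j x, fderiv ℝ (cr j) x ((EuclideanSpace.basisFun (Fin 3) ℝ) i)⟫_ℝ|)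
              ≤ ν j * (Cd * (‖cr j x‖ * ‖fderiv ℝ (cr j) x ((EuclideanSpace.basisFun (Fin 3) ℝ) i)‖)) := by
                gcongr
                · exact (hν j).le
                · exact hdψ i x
            _ = Cd * (s ^ 2 * ‖cr j x‖ * ‖fderiv ℝ (cr j) x ((EuclideanSpace.basisFun (Fin 3) ℝ) i)‖) := by rw [hs2]; ring
            _ ≤ Cd * ((s * ‖cr j x‖ ^ 2 + s ^ 3 * ‖fderiv ℝ (cr j) x ((EuclideanSpace.basisFun (Fin 3) ℝ) i)‖ ^ 2) / 2) :=
                mul_le_mul_of_nonneg_left (sq_mul_mul_le_aux hs0) hCd0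
        · -- inside the ball `B_r`: `Dψ = 0`
          have hz : ∑ i, fderiv ℝ ψ x ((EuclideanSpace.basisFun (Fin 3) ℝ) i) * ⟪cr j x, fderiv ℝ (cr j) x ((EuclideanSpace.basisFun (Fin 3) ℝ) i)⟫_ℝ = 0 :=
            Finset.sum_eq_zero fun i _ => by rw [hDψA x hxA]; simp
          rw [hz, mul_zero, norm_zero]
          refine Finset.sum_nonneg fun i _ => mul_nonneg hCd0 (div_nonneg (add_nonneg ?_ ?_) zero_le_two)
          · exact mul_nonneg hs0 (Set.indicator_nonneg (fun _ _ => sq_nonneg _) _)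
          · exact mul_nonneg (pow_nonneg hs0 3) (Set.indicator_nonneg (fun _ _ => sq_nonneg _) _)
      · -- outside `K`: `Dψ = 0`
        have hz : ∑ i, fderiv ℝ ψ x ((EuclideanSpace.basisFun (Fin 3) ℝ) i) * ⟪cr j x, fderiv ℝ (cr j) x ((EuclideanSpace.basisFun (Fin 3) ℝ) i)⟫_ℝ = 0 :=
          Finset.sum_eq_zero fun i _ => by rw [hsuppK x hxK]; simp
        rw [hz, mul_zero, norm_zero]
        refine Finset.sum_nonneg fun i _ => mul_nonneg hCd0 (div_nonneg (add_nonneg ?_ ?_) zero_le_two)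
        · exact mul_nonneg hs0 (Set.indicator_nonneg (fun _ _ => sq_nonneg _) _)
        · exact mul_nonneg (pow_nonneg hs0 3) (Set.indicator_nonneg (fun _ _ => sq_nonneg _) _)
    -- integrability of the majorant
    have hKi : Integrable (fun x => K.indicator (fun x => ‖cr j x‖ ^ 2) x) := by
      rw [integrable_indicator_iff hKm]
      have hcl : IntegrableOn (fun x => ‖cr j x‖ ^ 2) (closedBall (0 : (EuclideanSpace ℝ (Fin 3))) (max Rψ 1 + 1)) volume :=
        ((cc j).norm.pow 2).continuousOn.integrableOn_compact (isCompact_closedBall _ _)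
      exact hcl.mono_set ball_subset_closedBall
    have hAi : ∀ i, Integrable (fun x => A.indicator (fun x => ‖fderiv ℝ (cr j) x ((EuclideanSpace.basisFun (Fin 3) ℝ) i)‖ ^ 2) x) := by
      intro i
      rw [integrable_indicator_iff hAm]
      refine Integrable.integrableOn ?_
      refine (hInt j).mono (((cDc j).clm_apply continuous_const).norm.pow 2).aestronglyMeasurable
        (ae_of_all _ fun x => ?_)
      rw [Real.norm_eq_abs, Real.norm_eq_abs, abs_of_nonneg (sq_nonneg _), abs_of_nonneg (hFr0 j x),
        hFrsum j x]
      exact Finset.single_le_sum (f := fun i => ‖fderiv ℝ (cr j) x ((EuclideanSpace.basisFun (Fin 3) ℝ) i)‖ ^ 2)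
        (fun i _ => sq_nonneg _) (Finset.mem_univ i)
    have hIi : ∀ i, Integrable (fun x => Cd * ((s * K.indicator (fun x => ‖cr j x‖ ^ 2) x +
        s ^ 3 * A.indicator (fun x => ‖fderiv ℝ (cr j) x ((EuclideanSpace.basisFun (Fin 3) ℝ) i)‖ ^ 2) x) / 2)) := fun i =>
      (((hKi.const_mul s).add ((hAi i).const_mul _)).div_const _).const_mul _
    have hint : Integrable (fun x => ∑ i, Cd * ((s * K.indicator (fun x => ‖cr j x‖ ^ 2) x +
        s ^ 3 * A.indicator (fun x => ‖fderiv ℝ (cr j) x ((EuclideanSpace.basisFun (Fin 3) ℝ) i)‖ ^ 2) x) / 2)) :=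
      integrable_finsetSum _ fun i _ => hIi i
    have h := norm_integral_le_of_norm_le hint (ae_of_all _ hpt)
    rw [integral_const_mul, Real.norm_eq_abs] at h
    refine h.trans ?_
    rw [integral_finsetSum _ fun i _ => hIi i]
    have hterm : ∀ i, ∫ x, Cd * ((s * K.indicator (fun x => ‖cr j x‖ ^ 2) x +
        s ^ 3 * A.indicator (fun x => ‖fderiv ℝ (cr j) x ((EuclideanSpace.basisFun (Fin 3) ℝ) i)‖ ^ 2) x) / 2) =
        Cd * ((s * ∫ x in K, ‖cr j x‖ ^ 2) +
          s ^ 3 * ∫ x in A, ‖fderiv ℝ (cr j) x ((EuclideanSpace.basisFun (Fin 3) ℝ) i)‖ ^ 2) / 2 := by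
      intro i
      rw [integral_const_mul, integral_div, integral_add (hKi.const_mul s) ((hAi i).const_mul _),
        integral_const_mul, integral_const_mul, integral_indicator hKm, integral_indicator hAm]
      ring
    simp_rw [hterm]
    have hGsum : ∑ i, ∫ x in A, ‖fderiv ℝ (cr j) x ((EuclideanSpace.basisFun (Fin 3) ℝ) i)‖ ^ 2 = G j := by
      simp only [hG_def]
      rw [← integral_finsetSum _ fun i _ => (integrable_indicator_iff hAm).1 (hAi i)]
      exact integral_congr_ae (ae_of_all _ fun x => (hFrsum j x).symm)
    have hsum : ∑ i : Fin 3, Cd * ((s * ∫ x in K, ‖cr j x‖ ^ 2) +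
        s ^ 3 * ∫ x in A, ‖fderiv ℝ (cr j) x ((EuclideanSpace.basisFun (Fin 3) ℝ) i)‖ ^ 2) / 2 =
        Cd * (3 * (s * ∫ x in K, ‖cr j x‖ ^ 2) + s ^ 3 * G j) / 2 := by
      rw [← hGsum]
      simp only [Fin.sum_univ_three]
      ring
    rw [hsum]
    have hs3 : s ^ 3 * G j = s * (ν j * G j) := by rw [← hs2]; ring
    rw [hs3]
    have hEj : s * ∫ x in K, ‖cr j x‖ ^ 2 ≤ s * CK := mul_le_mul_of_nonneg_left (hCK j) hs0
    have : Cd * (3 * (s * ∫ x in K, ‖cr j x‖ ^ 2) + s * (ν j * G j)) / 2 ≤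
        Cd * (3 * (s * CK) + s * (ν j * G j)) / 2 := by
      gcongr
    exact this
  -- the dominating vanishing sequence
  set o : ℕ → ℝ := fun j => (1 + Cψ) * (ν j * G j) +
      Cd * (3 * (Real.sqrt (ν j) * CK) + Real.sqrt (ν j) * (ν j * G j)) / 2 with ho_def
  have hνG : Tendsto (fun j => ν j * G j) atTop (𝓝 0) := hconc r hr
  have hsq : Tendsto (fun j => Real.sqrt (ν j)) atTop (𝓝 0) := by
    have h := (Real.continuous_sqrt.tendsto 0).comp hν0
    rw [Real.sqrt_zero] at h
    exact h
  have hlim : Tendsto o atTop (𝓝 0) := by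
    have h1 : Tendsto (fun j => (1 + Cψ) * (ν j * G j)) atTop (𝓝 0) := by
      simpa using hνG.const_mul (1 + Cψ)
    have h2 : Tendsto (fun j => Cd * (3 * (Real.sqrt (ν j) * CK) +
        Real.sqrt (ν j) * (ν j * G j)) / 2) atTop (𝓝 0) := by
      have ha : Tendsto (fun j => 3 * (Real.sqrt (ν j) * CK)) atTop (𝓝 0) := by
        simpa using (hsq.mul_const CK).const_mul 3
      have hb : Tendsto (fun j => Real.sqrt (ν j) * (ν j * G j)) atTop (𝓝 0) := by
        simpa using hsq.mul hνG
      simpa using ((ha.add hb).const_mul Cd).div_const 2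
    simpa [ho_def] using h1.add h2
  -- squeeze `|FL j − D| ≤ o j`
  have hbound : ∀ j, |FL j - D| ≤ o j := by
    intro j
    have h1 : FL j - D = (ν j * T1 j - D) + ν j * T2 j := by rw [hid j]; ring
    rw [h1]
    calc |ν j * T1 j - D + ν j * T2 j| ≤ |ν j * T1 j - D| + |ν j * T2 j| := abs_add_le _ _
      _ ≤ o j := by simp only [ho_def]; linarith [hT1 j, hT2 j]
  rw [tendsto_iff_norm_sub_tendsto_zero]
  refine squeeze_zero_norm (fun j => ?_) hlim
  simpa [Real.norm_eq_abs, abs_abs] using hbound j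

/-- **Locally bounded energy from convergence to the cone.** If `∫_{B_R}‖c_j − V‖² → 0` for every
`R > 0` (last clause of `stub_solitonCoreFamily`), the `c_j` are continuous and `‖V‖²` is
integrable on balls, then `sup_j ∫_{B_R}‖c_j‖² < ∞` for every `R > 0`
(`‖c_j‖² ≤ 2‖c_j − V‖² + 2‖V‖²`). [folklore] -/
theorem coreFamily_locallyBoundedEnergy
    (cr : ℕ → (EuclideanSpace ℝ (Fin 3)) → (EuclideanSpace ℝ (Fin 3))) (hc : ∀ j, Continuous (cr j)) (V : (EuclideanSpace ℝ (Fin 3)) → (EuclideanSpace ℝ (Fin 3)))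
    (hVm : AEStronglyMeasurable V volume)
    (hV : ∀ R : ℝ, 0 < R → IntegrableOn (fun x => ‖V x‖ ^ 2) (ball (0 : (EuclideanSpace ℝ (Fin 3))) R) volume)
    (hL2 : ∀ R : ℝ, 0 < R → Tendsto (fun j => ∫ y in ball (0 : (EuclideanSpace ℝ (Fin 3))) R, ‖cr j y - V y‖ ^ 2)
      atTop (𝓝 0)) :
    ∀ R : ℝ, 0 < R → ∃ C : ℝ, ∀ j, ∫ y in ball (0 : (EuclideanSpace ℝ (Fin 3))) R, ‖cr j y‖ ^ 2 ≤ C := by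
  intro R hR
  set B : Set (EuclideanSpace ℝ (Fin 3)) := ball (0 : (EuclideanSpace ℝ (Fin 3))) R with hB_def
  have hBm : MeasurableSet B := measurableSet_ball
  have hμB : volume B < ⊤ := measure_ball_lt_top
  -- integrability on the ball
  have hci : ∀ j, IntegrableOn (fun y => ‖cr j y‖ ^ 2) B volume := fun j =>
    (((hc j).norm.pow 2).continuousOn.integrableOn_compact (isCompact_closedBall (0 : (EuclideanSpace ℝ (Fin 3))) R)).mono_set
      ball_subset_closedBall
  have hdi : ∀ j, IntegrableOn (fun y => ‖cr j y - V y‖ ^ 2) B volume := by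
    intro j
    have hpt : ∀ y, ‖cr j y - V y‖ ^ 2 ≤ 2 * ‖cr j y‖ ^ 2 + 2 * ‖V y‖ ^ 2 := fun y => by
      have h1 : ‖cr j y - V y‖ ^ 2 ≤ (‖cr j y‖ + ‖V y‖) ^ 2 :=
        pow_le_pow_left₀ (norm_nonneg _) (norm_sub_le _ _) 2
      nlinarith [sq_nonneg (‖cr j y‖ - ‖V y‖)]
    refine Integrable.mono' (((hci j).const_mul 2).add ((hV R hR).const_mul 2)) ?_
      (ae_of_all _ fun y => ?_)
    · exact (((hc j).aestronglyMeasurable.sub hVm).norm.pow 2).restrict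
    · rw [Real.norm_eq_abs, abs_of_nonneg (sq_nonneg _)]
      exact hpt y
  -- the convergent sequence of defects is bounded
  obtain ⟨M, hM⟩ := (hL2 R hR).bddAbove_range
  have hM' : ∀ j, ∫ y in B, ‖cr j y - V y‖ ^ 2 ≤ M := fun j => hM ⟨j, rfl⟩
  refine ⟨2 * M + 2 * ∫ y in B, ‖V y‖ ^ 2, fun j => ?_⟩
  have hpt : ∀ y, ‖cr j y‖ ^ 2 ≤ 2 * ‖cr j y - V y‖ ^ 2 + 2 * ‖V y‖ ^ 2 := fun y => by
    have h1 : ‖cr j y‖ ^ 2 ≤ (‖cr j y - V y‖ + ‖V y‖) ^ 2 := by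
      refine pow_le_pow_left₀ (norm_nonneg _) ?_ 2
      calc ‖cr j y‖ = ‖(cr j y - V y) + V y‖ := by rw [sub_add_cancel]
        _ ≤ ‖cr j y - V y‖ + ‖V y‖ := norm_add_le _ _
    nlinarith [sq_nonneg (‖cr j y - V y‖ - ‖V y‖)]
  have hsum_int : IntegrableOn (fun y => 2 * ‖cr j y - V y‖ ^ 2 + 2 * ‖V y‖ ^ 2) B volume :=
    ((hdi j).const_mul 2).add ((hV R hR).const_mul 2)
  calc ∫ y in B, ‖cr j y‖ ^ 2 ≤ ∫ y in B, (2 * ‖cr j y - V y‖ ^ 2 + 2 * ‖V y‖ ^ 2) :=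
        setIntegral_mono (hci j) hsum_int hpt
    _ = 2 * (∫ y in B, ‖cr j y - V y‖ ^ 2) + 2 * ∫ y in B, ‖V y‖ ^ 2 := by
        rw [integral_add ((hdi j).const_mul 2) ((hV R hR).const_mul 2), integral_const_mul,
          integral_const_mul]
    _ ≤ 2 * M + 2 * ∫ y in B, ‖V y‖ ^ 2 := by linarith [hM' j]

end Summit.AnomalousDissipation.AnomalousDissipation.Theorems

end
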